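import Summits.AnomalousDissipation.AnomalousDissipation.Theses.EnsembleRigidity
import Summits.AnomalousDissipation.AnomalousDissipation.Theses.TameRoughRigidity
import Summits.AnomalousDissipation.AnomalousDissipation.Theorems.EnsembleRigidityDefs
import HarnessLib

/-!
# Sketch — crux `EnsembleRigidity.GPTameDefectFloor` (stmt-AnomalousDissipation-17938), crux-ideate k=2, round 1

Idea card `spill-catching-summability` (first lemmas) and the structural reduction `T ⟸ N`.

§0  `GPTameDefectFloor_of_NK` — PROVED: with `TameClosure_of` (stmt-18402, landed) the tame defect
    floor T is a corollary of Euler-coercivity N (`TameRoughRigidity.GPEulerCoercive`, stmt-18400): T and N are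
    now one open problem (the `gap` block of `Theorems.TameRoughRigidity.rigiditySplit_proof`, specialised).
§1  vocabulary: tail energy above Galerkin level `N`, spill tests (𝒱-fields without modes of level `≤ N`), spill
    pairing / spill norm of the level-`N` truncation, in-band defect of a resolved field.
§2  FIRST LEMMA `spill_catching` (provable now, L): for an exact finite-enstrophy steady dodger `u` of `f_GP`,
    the spill of its truncation `P_N u` is CAUGHT by the tail: `|σ_N(w)| ≤ (2‖P_N u‖_∞ ‖Q_N u‖₂ + ‖Q_N u‖₄²)‖∇w‖₂`
    with Bernstein `‖P_N u‖_∞² ≤ C·N·‖∇u‖₂²`; companions `tail_L4_interpolation` (Sobolev–Hölder) and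
    `tail_sum_le_enstrophy` (summation by parts, = ladder A1 of the sibling card tail-multiplier-ladder);
    consequence `spill_square_summable`: Σ_N min(s_N²/G, N s_N⁴/G³) < ∞ for every exact tame dodger.
§3  the OPEN content as Props — `SpillFloorGalerkin G₁` (near-Galerkin-dodgers at level `N` with enstrophy `≤ G₁`
    spill at least `s(N)` with Σ min(s², N s⁴) = ∞; floors may DECAY like `N^{-1/2}`) — and the Dirac-core reduction
    `noTameDodger_of_spillFloorGalerkin` (from §2, provable); the measure-level twin is stated in the card.
-/

set_option linter.dupNamespace false

noncomputable section

namespace Summit.AnomalousDissipation.AnomalousDissipation.Cruxes.GPTameDefectFloor.SpillCatching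

open MeasureTheory Filter Topology UnitAddTorus
open scoped InnerProductSpace RealInnerProductSpace ENNReal NNReal
open Literature.Analysis.FunctionSpaces Literature.Analysis.FluidPDE
open Summit.AnomalousDissipation.AnomalousDissipation.Theorems.EnsembleRigidity

/-- Local notation: real vector fields on `T³`. -/
local notation "Vec3" => (UnitAddTorus (Fin 3)) → (EuclideanSpace ℝ (Fin 3))
/-- Local notation: `L²(T³; ℝ³)`. -/
local notation "L2" => (Lp (EuclideanSpace ℝ (Fin 3)) 2 (volume : Measure (UnitAddTorus (Fin 3))))
/-- Local notation: the energy space `H`. -/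
local notation "H3" => (Torus.energySpace (Fin 3))

/-! ## §0  T is a corollary of N (tame closure K is landed) -/

/-- **T ⟸ N ∧ K.** Euler-coercivity of `f_GP` in the FMRT class (`TameRoughRigidity.GPEulerCoercive`, stmt-18400)
and tame closure (`TameRoughRigidity.TameClosure`, stmt-18402 — LANDED as
`Theorems.TameRoughRigidity.TameClosure.TameClosure_of`, module `Theorems/TameRoughRigidityTameClosure.lean`)
imply the tame defect floor `EnsembleRigidity.GPTameDefectFloor` (stmt-17938): if some tame class `(E, G₁)` had
no defect gap, tame closure would produce an exact stationary Euler statistics of `f_GP`, which N forbids.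
PROVED (no sorry). With the landed `TameClosure_of` this reads `GPEulerCoercive → GPTameDefectFloor`
(`GPTameDefectFloor_of_GPEulerCoercive hN := GPTameDefectFloor_of_NK hN TameClosure_of`; the import of the
`TameClosure` theorem module is left out of this sketch only because its farm olean was not yet built at check time). -/
theorem GPTameDefectFloor_of_NK
    (hN : Summit.AnomalousDissipation.AnomalousDissipation.Theses.TameRoughRigidity.GPEulerCoercive)
    (hK : Summit.AnomalousDissipation.AnomalousDissipation.Theses.TameRoughRigidity.TameClosure) :
    Summit.AnomalousDissipation.AnomalousDissipation.Theses.EnsembleRigidity.GPTameDefectFloor := by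
  intro f hf E G₁
  by_contra hcon
  push Not at hcon
  obtain ⟨μ, hμ, -⟩ := hK f hf E G₁ hcon
  exact hN f hf μ hμ

/-! ## §1  Vocabulary -/

/-- The resolved part `P_N u` of `u ∈ H` as an `L²` class. -/
def resolved (N : ℕ) (u : H3) : L2 := Torus.galerkinProj N (u : L2)

/-- Tail energy above Galerkin level `N`: `T_N(u) = ‖u − P_N u‖₂² = Σ_{|k| > N} |û_k|²`. -/
def tailEnergy (N : ℕ) (u : H3) : ℝ := ‖(u : L2) - resolved N u‖ ^ 2

/-- Spill test of level `N`: a smooth solenoidal mean-zero field with NO Fourier modes of Galerkin level `≤ N`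
(its `L²` class is killed by `P_N`), i.e. a pure "spill direction". Against such `w` the force `f_GP` (level 1)
is invisible and `(B(P_N u, P_N u), w)` is exactly the spill of the truncation. -/
def IsSpillTest (N : ℕ) (w : Vec3) : Prop :=
  Torus.IsSmooth w ∧ Torus.IsDivFree w ∧ Torus.HasZeroMean w ∧
    ∀ hw : MemLp w 2 (volume : Measure (UnitAddTorus (Fin 3))), Torus.galerkinProj N (hw.toLp w) = 0

/-- Spill pairing of the level-`N` truncation: `∫ (P_N u ⊗ P_N u) : ∇w = −(B(P_N u, P_N u), w)`. -/
def spillPairing (N : ℕ) (u : H3) (w : Vec3) : ℝ := Torus.inertialPairing (resolved N u) w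

/-- `Ḣ⁻¹` spill norm of the level-`N` truncation: the supremum of `|spillPairing N u w|` over spill tests of
unit gradient norm. -/
def spillNorm (N : ℕ) (u : H3) : ℝ :=
  sSup {r : ℝ | ∃ w : Vec3, IsSpillTest N w ∧ Torus.gradNormSq w ≤ 1 ∧ r = |spillPairing N u w|}

/-- In-band (Galerkin) forced-Euler defect of a field `y` against level-`N` tests (𝒱-fields whose `L²` class is
fixed by `P_N`), in the `Ḣ⁻¹` normalisation. For `y = P_N u` it measures how far the truncation is from an exact
GALERKIN dodger `P_N B(y,y) = f_GP`. -/
def inBandDefect (N : ℕ) (f : Vec3) (y : H3) : ℝ :=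
  sSup {r : ℝ | ∃ w : Vec3, Torus.IsSmooth w ∧ Torus.IsDivFree w ∧ Torus.HasZeroMean w ∧
    (∀ hw : MemLp w 2 (volume : Measure (UnitAddTorus (Fin 3))), Torus.galerkinProj N (hw.toLp w) = hw.toLp w) ∧
    Torus.gradNormSq w ≤ 1 ∧ r = |Torus.nsGeneratorPairing 0 f y w|}

/-! ## §2  First lemma: spill catching (provable now) -/

/-- **SPILL CATCHING (first lemma; provable now, size L).** There is a Bernstein constant `C` such that for every
exact finite-enstrophy steady weak dodger `u ∈ V` of `f_GP` (`P B(u,u) = f_GP` weakly), every level `N ≥ 1` and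
every spill test `w`, the spill of the truncation is caught by the tail:
`|∫(P_N u ⊗ P_N u):∇w| ≤ (2 √(C N ‖∇u‖₂² · T_N(u)) + ‖u − P_N u‖₄²) · ‖∇w‖₂`.
Proof: `nsGeneratorPairing 0 f_GP u w = 0` (steady) and `(f_GP, w) = 0` (no level-1 modes in `w`), so
`∫(u⊗u):∇w = 0`; expand `u = P_N u + Q_N u` (bilinearity of the inertial pairing, all products integrable for
`u ∈ V ⊂ L⁶`): `∫(P_N u⊗P_N u):∇w = −2∫(P_N u ⊗ Q_N u)_sym:∇w − ∫(Q_N u⊗Q_N u):∇w`; Cauchy–Schwarz with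
`‖P_N u‖_∞ ≤ Σ_{0<|k|≤N}|û_k| ≤ (Σ|k|²|û_k|²)^{1/2}(Σ_{0<|k|≤N}|k|⁻²)^{1/2}` and `Σ_{0<|k|≤N}|k|⁻² ≤ C' N`
(lattice count), Hölder for the last term. -/
theorem spill_catching :
    ∃ C : ℝ, 0 < C ∧ ∀ (f : Vec3), f = gpForce → ∀ (u : H3), (u : L2) ∈ Torus.energySpaceV (Fin 3) →
      Torus.IsSteadyWeakSolution 0 f u → ∀ (N : ℕ), 1 ≤ N → ∀ (w : Vec3), IsSpillTest N w →
        |spillPairing N u w| ≤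
          (2 * Real.sqrt (C * N * (Torus.eGradNormSq ((u : L2) : Vec3)).toReal * tailEnergy N u) +
              (eLpNorm (((u : L2) - resolved N u : L2) : Vec3) 4
                (volume : Measure (UnitAddTorus (Fin 3)))).toReal ^ 2) *
            Real.sqrt (Torus.gradNormSq w) := by
  sorry

/-- **Tail interpolation (provable now, M).** Sobolev `H¹(T³) ⊂ L⁶` and Hölder: `‖Q_N u‖₄² ≤ ‖Q_N u‖₂^{1/2}‖Q_N u‖₆^{3/2}
≤ C · T_N(u)^{1/4} · ‖∇u‖₂^{3/2}`. -/
theorem tail_L4_interpolation :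
    ∃ C : ℝ, 0 < C ∧ ∀ (u : H3), (u : L2) ∈ Torus.energySpaceV (Fin 3) → ∀ N : ℕ,
      (eLpNorm (((u : L2) - resolved N u : L2) : Vec3) 4 (volume : Measure (UnitAddTorus (Fin 3)))).toReal ^ 2 ≤
        C * (tailEnergy N u) ^ (1 / 4 : ℝ) * ((Torus.eGradNormSq ((u : L2) : Vec3)).toReal) ^ (3 / 4 : ℝ) := by
  sorry

/-- **Summation by parts (provable now, M; = A1 `EnstrophyDominatesTails` of the sibling card
tail-multiplier-ladder).** `Σ_{N=1}^{K} N · T_N(u) ≤ ‖∇u‖₂² / (4π²)` for finite-enstrophy `u`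
(`Σ_{1 ≤ N < |k|} N ≤ |k|²`, Parseval). -/
theorem tail_sum_le_enstrophy (u : H3) (hu : (u : L2) ∈ Torus.energySpaceV (Fin 3)) (K : ℕ) :
    ∑ N ∈ Finset.Icc 1 K, (N : ℝ) * tailEnergy N u ≤
      (Torus.eGradNormSq ((u : L2) : Vec3)).toReal / (4 * Real.pi ^ 2) := by
  sorry

/-- **SPILLS OF AN EXACT TAME DODGER ARE SQUARE-SUMMABLE (consequence of the three lemmas, M).** With
`G = ‖∇u‖₂²`: from `spill_catching` + `tail_L4_interpolation`, `s_N ≤ 2√(C N G T_N) + C' T_N^{1/4} G^{3/4}`, hence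
`T_N ≥ min(s_N²/(16 C N G), s_N⁴/(16 C'⁴ G³))`; weight by `N` and sum with `tail_sum_le_enstrophy`. So the
truncations of an exact dodger are NEAR-GALERKIN-DODGERS WITH SUMMABLY SMALL SPILL — the quantitative form of
"an exact dodger's Galerkin shadows must stop spilling", against the census observation that Galerkin dodgers of
`f_GP` spill `≥ 0.15` at every resolution reached. -/
theorem spill_square_summable :
    ∃ C : ℝ, 0 < C ∧ ∀ (f : Vec3), f = gpForce → ∀ (u : H3), (u : L2) ∈ Torus.energySpaceV (Fin 3) →
      Torus.IsSteadyWeakSolution 0 f u → ∀ K : ℕ,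
        ∑ N ∈ Finset.Icc 1 K,
            min (spillNorm N u ^ 2 / (1 + (Torus.eGradNormSq ((u : L2) : Vec3)).toReal))
              ((N : ℝ) * spillNorm N u ^ 4 / (1 + (Torus.eGradNormSq ((u : L2) : Vec3)).toReal) ^ 3) ≤
          C * (1 + (Torus.eGradNormSq ((u : L2) : Vec3)).toReal) := by
  sorry

/-! ## §3  The open content (Dirac core) and the reduction -/

/-- **Truncations of exact dodgers are near-Galerkin-dodgers (provable now, L).** The in-band defect of `P_N u`
is the same cross + tail–tail stress read on level-`N` tests: `≤ 2√(C N G T_N) + C' T_N^{1/4}G^{3/4} ≤ C'' G/√N`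
using `T_N ≤ G/(4π²N²)`. -/
theorem truncation_inBand_small :
    ∃ C : ℝ, 0 < C ∧ ∀ (f : Vec3), f = gpForce → ∀ (u : H3), (u : L2) ∈ Torus.energySpaceV (Fin 3) →
      Torus.IsSteadyWeakSolution 0 f u → ∀ (N : ℕ), 1 ≤ N → ∀ (y : H3), (y : L2) = resolved N u →
        inBandDefect N f y ≤ C * (1 + (Torus.eGradNormSq ((u : L2) : Vec3)).toReal) / Real.sqrt (N : ℝ) := by
  sorry

/-- **SPILL FLOOR over near-Galerkin-dodgers (the OPEN content, Dirac core; finite-dimensional per level).**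
At enstrophy level `G₁`: floors `s(N) ≥ 0` with NON-SUMMABLE `Σ_N min(s(N)², N s(N)⁴) = ∞` (so `s(N) ≍ N^{-1/2}`
is allowed) and tolerances `δ(N) ≥ c G₁/√N` (not below the a-priori in-band error of truncations) such that every
level-`N` resolved field `y ∈ P_N H` with `‖∇y‖₂² ≤ G₁` and in-band defect `≤ δ(N)` spills at least `s(N)`.
The `δ = 0` instance at each `N` is the census quantity "least spill of an exact Galerkin dodger with `G ≤ G₁`". -/
def SpillFloorGalerkin (G₁ : ℝ) : Prop :=
  ∃ (s δ : ℕ → ℝ) (N₀ : ℕ) (c : ℝ), 0 < c ∧ 1 ≤ N₀ ∧ (∀ N, 0 ≤ s N) ∧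
    (∀ N, N₀ ≤ N → c * (1 + G₁) / Real.sqrt (N : ℝ) ≤ δ N) ∧
    Tendsto (fun K : ℕ => ∑ N ∈ Finset.Icc N₀ K, min (s N ^ 2) ((N : ℝ) * s N ^ 4)) atTop atTop ∧
    ∀ N, N₀ ≤ N → ∀ y : H3, (y : L2) ∈ Torus.galerkinSpace N →
      (Torus.eGradNormSq ((y : L2) : Vec3)).toReal ≤ G₁ → inBandDefect N gpForce y ≤ δ N →
        s N ≤ spillNorm N y

/-- **Dirac-core reduction (provable from §2 + `truncation_inBand_small`, M).** A spill floor at level `G₁` excludes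
every exact steady weak dodger of `f_GP` with enstrophy `≤ G₁`: its truncations would be near-Galerkin-dodgers
(tolerance met for `N ≥ N₀`), hence spill `≥ s(N)`, hence by spill catching carry tail energy
`T_N ≥ c·min(s(N)²/(N G₁), s(N)⁴/G₁³)`, contradicting `Σ N T_N ≤ G₁/(4π²)`. -/
theorem noTameDodger_of_spillFloorGalerkin (G₁ : ℝ) (h : SpillFloorGalerkin G₁) :
    ∀ (u : H3), (u : L2) ∈ Torus.energySpaceV (Fin 3) →
      (Torus.eGradNormSq ((u : L2) : Vec3)).toReal ≤ G₁ → ¬ Torus.IsSteadyWeakSolution 0 gpForce u := by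
  sorry

end Summit.AnomalousDissipation.AnomalousDissipation.Cruxes.GPTameDefectFloor.SpillCatching
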